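import Summits.AtomisticToContinuum.Crystallization.Theorems.FrustratedLawDichotomyStrainedPatchHomForceSum
import Summits.AtomisticToContinuum.Crystallization.Theorems.FrustratedLawDichotomyStrainedPatchHomEntryQuickHcp
import Summits.AtomisticToContinuum.Crystallization.Theorems.FrustratedLawDichotomyStrainedPatchHomEntryTreeCert

/-!
# (C′) FORCE/EXEMPT PRUNE, part 3: the hcp verdict WITH the exempt prune, `entryLeafOKHX := forceOut ∨ entryLeafOKHQ μ`, and `(H) HomFloor m` re-booked
# (27623 strained-patch piece, hcp half; decomp-a2c hand-2 g27 — critic row 1019 (ask 1): «(H)-hcp RE-BOOKED := hcpHalf_of_entryTree ⟸ treeOK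
# entryLeafOKHX t rootCH rootWH = true for a verdict entryLeafOKHX c w := forceOut c w ∨ entryLeafOKHQ …»)

Parts 1–2 (`…HomForceKit`, `…HomForceSum`) give the per-direction leaf `forceOutDir en ed sn sd c w` with `forceOutDir_sound` (the `hver` prune disjunct
`ExemptNear (9/5) ExRec` for every `(U, ξ)` of the box, needing `‖U − 1‖ ≤ 1/4` — a hypothesis of `hver` — and `‖ξ‖ ≤ 1/4` — NOT a hypothesis of
`hver`, whose boxes tile the CUBE `[−1/4, 1/4]³`).  This module

* §1 `xiBallOK c w` — the shuffle box lies in the ball `‖ξ‖ ≤ 1/4` (`Σᵢ (|cᵢ| + wᵢ)² ≤ (SC/4)²`), with `norm_le_quarter_of_xiBallOK`;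
* §2 ★ the direction MENU `forceOut c w` := `xiBallOK` ∧ (one of the eight leaves `forceOutDir e (s = 10⁻⁶)` fires, `e ∈ {±x̂, ±(½, ∓√3/2·…) rational
  basal sextet, ±ẑ}`), `forceOut_sound` in the EXACT `hver` shape of `…HomEntryFlipHcp.hcpHalf_of_entryTreeShuf` (middle disjunct of the prune);
* §3 ★★ `entryLeafOKHX μ := forceOut ∨ entryLeafOKHQ μ` with `entryLeafOKHX_sound` (quick verdict soundness through `entryLeafOKHQ_imp` +
  `entryLeafOKHVK_sound`), ★★ `hcpHalf_of_entryTreeHX`, and ★★★ `homFloor_of_entryTrees6RBKP_HX` / `homFloor_625_of_entryTrees6RBKP_HX` — `(H) HomFloor m`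
  from the fcc ∃-tree fact of record and an hcp ∃-tree fact over the NEW verdict (the re-booking of row 1019, typed; the false-as-stated `hH` over
  `entryLeafOKHVK` is no longer referenced).

The strength of the booking is that of `forceOutDir` (measured in part 2: closes at half-width ≲ 2⁻¹²; the centred successor re-uses every theorem here
through `forceOutDir_sound`'s interface).  Definitions computable; 0 sorry; axioms standard; no instances / notation.  `--supports stmt-AtomisticToContinuum-27623`.
-/

namespace Summit.AtomisticToContinuum.Crystallization.Theorems.FrustratedLawDichotomyStrainedPatchHomForceHcp

open scoped BigOperators RealInnerProductSpace
open Literature.Analysis.ValidatedNumerics.Numerics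
open Summit.AtomisticToContinuum.Crystallization.Theorems.ChargedEnergyGapNegative (E3)
open Summit.AtomisticToContinuum.Crystallization.Theorems.FrustratedLawDichotomySchurCut (effPot w₄₅ ω₄)
open Summit.AtomisticToContinuum.Crystallization.Theorems.FrustratedLawDichotomyAveragingRuleTightFree (TightNearCap BadNearCap)
open Summit.AtomisticToContinuum.Crystallization.Theorems.FrustratedLawDichotomyExemptAbsorption (ExemptNear)
open Summit.AtomisticToContinuum.Crystallization.Theorems.FrustratedLawDichotomyStrainedPatchHomSplit
open Summit.AtomisticToContinuum.Crystallization.Theorems.FrustratedLawDichotomyStrainedPatchHomPrunedPolar (homFloor_of_prunedBoxSums_selfAdjoint)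
open Summit.AtomisticToContinuum.Crystallization.Theorems.FrustratedLawDichotomyStrainedPatchHomCertTree (CertTree treeOK)
open Summit.AtomisticToContinuum.Crystallization.Theorems.FrustratedLawDichotomyStrainedPatchHomEntryGram (rootC rootW)
open Summit.AtomisticToContinuum.Crystallization.Theorems.FrustratedLawDichotomyStrainedPatchHomEntryGramHcp (rootCH rootWH)
open Summit.AtomisticToContinuum.Crystallization.Theorems.FrustratedLawDichotomyStrainedPatchHomEntryTable (muRec muRec_ok)
open Summit.AtomisticToContinuum.Crystallization.Theorems.FrustratedLawDichotomyStrainedPatchHomEntryFlipHcp (HcpDich hcpHalf_of_entryTreeShuf)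
open Summit.AtomisticToContinuum.Crystallization.Theorems.FrustratedLawDichotomyStrainedPatchHomEntryTableP (entryLeafOK6RBKP)
open Summit.AtomisticToContinuum.Crystallization.Theorems.FrustratedLawDichotomyStrainedPatchHomLeafTableCheckHcpV (entryLeafOKHVK entryLeafOKHVK_sound)
open Summit.AtomisticToContinuum.Crystallization.Theorems.FrustratedLawDichotomyStrainedPatchHomEntryQuickHcp (entryLeafOKHQ entryLeafOKHQ_imp)
open Summit.AtomisticToContinuum.Crystallization.Theorems.FrustratedLawDichotomyStrainedPatchHomEntryTreeCert (fccHalf_of_entryTree6RBKP)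
open Summit.AtomisticToContinuum.Crystallization.Theorems.FrustratedLawDichotomyStrainedPatchHomForceSum (forceOutDir forceOutDir_sound)

/-! ## §1. The shuffle box inside the quarter ball -/

/-- The shuffle box `∏ᵢ [cᵢ − wᵢ, cᵢ + wᵢ]` lies in the ball `‖ξ‖ ≤ 1/4`: `16·Σᵢ (|cᵢ| + |wᵢ|)² ≤ SC²`. -/
def xiBallOK (c w : (Fin 3 × Fin 3) ⊕ Fin 3 → ℤ) : Bool :=
  decide (16 * ((|c (Sum.inr 0)| + |w (Sum.inr 0)|) ^ 2 + (|c (Sum.inr 1)| + |w (Sum.inr 1)|) ^ 2 + (|c (Sum.inr 2)| + |w (Sum.inr 2)|) ^ 2) ≤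
    (SC : ℤ) ^ 2)

/-- `xiBallOK` ⟹ every `ξ` of the shuffle box has `‖ξ‖ ≤ 1/4`. [folklore] -/
theorem norm_le_quarter_of_xiBallOK {c w : (Fin 3 × Fin 3) ⊕ Fin 3 → ℤ} (h : xiBallOK c w = true) {ξ : E3}
    (hξ : ∀ i : Fin 3, |ξ i - (c (Sum.inr i) : ℝ) / SC| ≤ (w (Sum.inr i) : ℝ) / SC) : ‖ξ‖ ≤ 1 / 4 := by
  simp only [xiBallOK, decide_eq_true_eq] at h
  have hS := SC_pos
  have hb : ∀ i : Fin 3, |ξ i| * SC ≤ |(c (Sum.inr i) : ℝ)| + |(w (Sum.inr i) : ℝ)| := by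
    intro i
    have h1 := hξ i
    have h2 : |ξ i| ≤ |(c (Sum.inr i) : ℝ) / SC| + (w (Sum.inr i) : ℝ) / SC := by
      have := abs_sub_abs_le_abs_sub (ξ i) ((c (Sum.inr i) : ℝ) / SC)
      linarith
    rw [abs_div, abs_of_pos hS] at h2
    have h3 := mul_le_mul_of_nonneg_right h2 hS.le
    rw [add_mul, div_mul_cancel₀ _ hS.ne', div_mul_cancel₀ _ hS.ne'] at h3
    exact h3.trans (add_le_add le_rfl (le_abs_self _))
  have hR : (16 : ℝ) * ((|(c (Sum.inr 0) : ℝ)| + |(w (Sum.inr 0) : ℝ)|) ^ 2 + (|(c (Sum.inr 1) : ℝ)| + |(w (Sum.inr 1) : ℝ)|) ^ 2 +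
      (|(c (Sum.inr 2) : ℝ)| + |(w (Sum.inr 2) : ℝ)|) ^ 2) ≤ (SC : ℝ) ^ 2 := by
    have := h
    exact_mod_cast this
  have hn : ‖ξ‖ ^ 2 = |ξ 0| ^ 2 + |ξ 1| ^ 2 + |ξ 2| ^ 2 := by
    rw [EuclideanSpace.norm_eq, Real.sq_sqrt (by positivity), Fin.sum_univ_three]
    simp only [Real.norm_eq_abs]
  have h0 := hb 0; have h1 := hb 1; have h2 := hb 2
  have hsq : (‖ξ‖ * SC) ^ 2 ≤ ((SC : ℝ) / 4) ^ 2 := by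
    rw [mul_pow, hn]
    nlinarith [abs_nonneg (ξ 0), abs_nonneg (ξ 1), abs_nonneg (ξ 2), sq_nonneg (|ξ 0| * SC), sq_nonneg (|ξ 1| * SC), sq_nonneg (|ξ 2| * SC),
      mul_le_mul (hb 0) (hb 0) (by positivity) (by positivity), mul_le_mul (hb 1) (hb 1) (by positivity) (by positivity),
      mul_le_mul (hb 2) (hb 2) (by positivity) (by positivity)]
  have := (abs_le_of_sq_le_sq' hsq (by positivity)).2
  rw [le_div_iff₀ (by norm_num : (0 : ℝ) < 4)]
  nlinarith

/-! ## §2. The direction menu -/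

/-- The eight move directions (rational, at most unit): `±x̂`, `±(½, √3/2)`, `±(−½, √3/2)` as `(±500, ±866, 0)/1000`, `±ẑ`; step `s = 10⁻⁶`. -/
def forceMenu (c w : (Fin 3 × Fin 3) ⊕ Fin 3 → ℤ) : Bool :=
  forceOutDir ![1, 0, 0] 1 1 1000000 c w || forceOutDir ![-1, 0, 0] 1 1 1000000 c w ||
  forceOutDir ![500, 866, 0] 1000 1 1000000 c w || forceOutDir ![-500, -866, 0] 1000 1 1000000 c w ||
  forceOutDir ![-500, 866, 0] 1000 1 1000000 c w || forceOutDir ![500, -866, 0] 1000 1 1000000 c w ||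
  forceOutDir ![0, 0, 1] 1 1 1000000 c w || forceOutDir ![0, 0, -1] 1 1 1000000 c w

/-- ★ **`forceOut`** — the force/exempt prune verdict on an entry/shuffle box: box inside the quarter ball and some menu direction fires. -/
def forceOut (c w : (Fin 3 × Fin 3) ⊕ Fin 3 → ℤ) : Bool := xiBallOK c w && forceMenu c w

/-- ★ **SOUNDNESS OF `forceOut` IN THE `hver` SHAPE** of `…HomEntryFlipHcp.hcpHalf_of_entryTreeShuf` (the prune disjunct, middle alternative; the floor
disjunct is never used). [folklore] -/
theorem forceOut_sound {μ : ℤ} {c w : (Fin 3 × Fin 3) ⊕ Fin 3 → ℤ} (h : forceOut c w = true) (U : E3 →L[ℝ] E3) (ξ : E3)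
    (_hsa : ∀ v v' : E3, ⟪U v, v'⟫ = ⟪v, U v'⟫) (hU : ‖U - 1‖ ≤ 1 / 4)
    (hbox : ∀ ab : Fin 3 × Fin 3, |(U (EuclideanSpace.single ab.2 (1 : ℝ))) ab.1 - (c (Sum.inl ab) : ℝ) / SC| ≤ (w (Sum.inl ab) : ℝ) / SC)
    (hξ : ∀ i : Fin 3, |ξ i - (c (Sum.inr i) : ℝ) / SC| ≤ (w (Sum.inr i) : ℝ) / SC) (_h0 : 0 ≤ ξ 0) (_h2 : 0 ≤ ξ 2) :
    (∀ (M : ℕ) (z : Fin M → E3) (cc : Fin M), Function.Injective z →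
        Set.range z = {x : E3 | dist x (z cc) ≤ 133 / 10 ∧ ∃ a : Fin 3 → ℤ,
          x = z cc + latPt U hexFrame a ∨ x = z cc + latPt U hexFrame a + U (hcpShift + ξ)} →
        TightNearCap (9 / 5) (3 / 2) z cc ∨ ExemptNear (9 / 5) ExRec z cc ∨ BadNearCap (9 / 5) (3 / 2) z cc) ∨
      (μ : ℝ) / SC ≤ ∑ b ∈ (Fintype.piFinset fun _ : Fin 3 => Finset.Icc (-7 : ℤ) 7).filter (fun b => b ≠ 0), effPot w₄₅ ω₄ (3 / 400) ‖latPt U hexFrame b‖ +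
        ∑ b ∈ (Fintype.piFinset fun _ : Fin 3 => Finset.Icc (-7 : ℤ) 7), effPot w₄₅ ω₄ (3 / 400) ‖latPt U hexFrame b + U (hcpShift + ξ)‖ := by
  simp only [forceOut, Bool.and_eq_true] at h
  obtain ⟨hball, hmenu⟩ := h
  have hξn := norm_le_quarter_of_xiBallOK hball hξ
  left
  simp only [forceMenu, Bool.or_eq_true] at hmenu
  rcases hmenu with ((((((h | h) | h) | h) | h) | h) | h) | h <;> exact forceOutDir_sound h U ξ hU hξn hbox hξ

/-! ## §3. The verdict with the exempt prune and `(H) HomFloor m` re-booked -/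

/-- ★★ **THE hcp VERDICT WITH THE EXEMPT PRUNE** (row 1019): `forceOut ∨ entryLeafOKHQ μ`. -/
def entryLeafOKHX (μ : ℤ) (c w : (Fin 3 × Fin 3) ⊕ Fin 3 → ℤ) : Bool := forceOut c w || entryLeafOKHQ μ c w

/-- ★★ Soundness of `entryLeafOKHX` in the `hver` shape. [folklore] -/
theorem entryLeafOKHX_sound {μ : ℤ} {c w : (Fin 3 × Fin 3) ⊕ Fin 3 → ℤ} (h : entryLeafOKHX μ c w = true) (U : E3 →L[ℝ] E3) (ξ : E3)
    (hsa : ∀ v v' : E3, ⟪U v, v'⟫ = ⟪v, U v'⟫) (hU : ‖U - 1‖ ≤ 1 / 4)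
    (hbox : ∀ ab : Fin 3 × Fin 3, |(U (EuclideanSpace.single ab.2 (1 : ℝ))) ab.1 - (c (Sum.inl ab) : ℝ) / SC| ≤ (w (Sum.inl ab) : ℝ) / SC)
    (hξ : ∀ i : Fin 3, |ξ i - (c (Sum.inr i) : ℝ) / SC| ≤ (w (Sum.inr i) : ℝ) / SC) (h0 : 0 ≤ ξ 0) (h2 : 0 ≤ ξ 2) :
    (∀ (M : ℕ) (z : Fin M → E3) (cc : Fin M), Function.Injective z →
        Set.range z = {x : E3 | dist x (z cc) ≤ 133 / 10 ∧ ∃ a : Fin 3 → ℤ,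
          x = z cc + latPt U hexFrame a ∨ x = z cc + latPt U hexFrame a + U (hcpShift + ξ)} →
        TightNearCap (9 / 5) (3 / 2) z cc ∨ ExemptNear (9 / 5) ExRec z cc ∨ BadNearCap (9 / 5) (3 / 2) z cc) ∨
      (μ : ℝ) / SC ≤ ∑ b ∈ (Fintype.piFinset fun _ : Fin 3 => Finset.Icc (-7 : ℤ) 7).filter (fun b => b ≠ 0), effPot w₄₅ ω₄ (3 / 400) ‖latPt U hexFrame b‖ +
        ∑ b ∈ (Fintype.piFinset fun _ : Fin 3 => Finset.Icc (-7 : ℤ) 7), effPot w₄₅ ω₄ (3 / 400) ‖latPt U hexFrame b + U (hcpShift + ξ)‖ := by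
  simp only [entryLeafOKHX, Bool.or_eq_true] at h
  rcases h with h | h
  · exact forceOut_sound (μ := μ) h U ξ hsa hU hbox hξ h0 h2
  · exact entryLeafOKHVK_sound (entryLeafOKHQ_imp μ c w h) U ξ hsa hU hbox hξ h0 h2

/-- ★★ The hcp half from ONE certificate tree over the verdict WITH the exempt prune. [folklore] -/
theorem hcpHalf_of_entryTreeHX {m : ℝ} {μ : ℤ} (hμ : 2 * (m + (-(7175 / 10000) + 3 / 400)) * SC ≤ μ) {t : CertTree ((Fin 3 × Fin 3) ⊕ Fin 3)}
    (h : treeOK (entryLeafOKHX μ) t rootCH rootWH = true) :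
    ∀ (U : E3 →L[ℝ] E3) (ξ : E3), (∀ v w : E3, inner ℝ (U v) w = inner ℝ v (U w)) → (∀ w : E3, 0 ≤ inner ℝ w (U w)) →
      ‖U - 1‖ ≤ 1 / 4 → ‖ξ‖ ≤ 1 / 4 → HcpDich m U ξ :=
  hcpHalf_of_entryTreeShuf hμ (entryLeafOKHX μ) (fun _ _ hv U ξ hsa hU hbox hξ h0 h2 => entryLeafOKHX_sound hv U ξ hsa hU hbox hξ h0 h2) h

/-- ★★★ **`(H) HomFloor m` RE-BOOKED (critic row 1019)**: the fcc ∃-tree fact of record (`entryLeafOK6RBKP μ`) and an hcp ∃-tree fact over the verdict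
WITH the exempt prune (`entryLeafOKHX μ`) give `HomFloor m`, every `m`, `μ` with `2(m + e_W)SC ≤ μ`. [folklore] -/
theorem homFloor_of_entryTrees6RBKP_HX {m : ℝ} {μ : ℤ} (hμ : 2 * (m + (-(7175 / 10000) + 3 / 400)) * SC ≤ μ)
    (hF : ∃ t : CertTree (Fin 3 × Fin 3), treeOK (entryLeafOK6RBKP μ) t rootC rootW = true)
    (hH : ∃ t : CertTree ((Fin 3 × Fin 3) ⊕ Fin 3), treeOK (entryLeafOKHX μ) t rootCH rootWH = true) : HomFloor m := by
  obtain ⟨tF, htF⟩ := hF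
  obtain ⟨tH, htH⟩ := hH
  exact homFloor_of_prunedBoxSums_selfAdjoint (fccHalf_of_entryTree6RBKP hμ htF) (hcpHalf_of_entryTreeHX hμ htH)

/-- ★★★ **`(H) HomFloor (1/625)` in the re-booked currency** (`μ = muRec`). [folklore] -/
theorem homFloor_625_of_entryTrees6RBKP_HX
    (hF : ∃ t : CertTree (Fin 3 × Fin 3), treeOK (entryLeafOK6RBKP muRec) t rootC rootW = true)
    (hH : ∃ t : CertTree ((Fin 3 × Fin 3) ⊕ Fin 3), treeOK (entryLeafOKHX muRec) t rootCH rootWH = true) : HomFloor (1 / 625) :=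
  homFloor_of_entryTrees6RBKP_HX muRec_ok hF hH

end Summit.AtomisticToContinuum.Crystallization.Theorems.FrustratedLawDichotomyStrainedPatchHomForceHcp
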